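import Summits.QuantumFields.YangMills.Theorems.BalabanUVNodesN11CRLetteredMemberLetters
import Summits.QuantumFields.YangMills.Theorems.BalabanUVNodesN11BgRowGaugeLiftOfPowM
import Literature.MathematicalPhysics.QuantumFieldTheory.Balaban1983to89.Node00.LargeFieldBackgroundCoPOfRecordB
import Summits.QuantumFields.YangMills.Theorems.BalabanUVNodesN11BgRowGaugeSocketsGBPrint

/-!
# DAG node N11 ∕ NODE 00 ROW P11 — THE GUARD-FREE ROW `bg` AT THE cR-LETTERED MEMBER OVER PRINT'S [II] (2.3) DATUM: the `(Adm, lamDatum F, Dat, UbgMSCoPOfRecordB)` twin of dag-n11-w5's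
# `…N11BgRowGaugeRAtCRLetteredMember` (p629786; TRAIN-N11 item (9)), with the Stage-2 SEAM displayed as ONE hypothesis `hseam` and the (7) data transfer as ONE hypothesis `hDat` —
# green BEFORE and AFTER the seam edit

HEADER — WORK-UNIT METADATA.  Cell `pub-ymgap`, YM-PLAN Track A (HUMAN RULING D-0062 ∕ D-0149 width seats), seat `pub-ymgap-dag-n11-w3` (g6; WIDTH SEAT 3∕4 on NODE n11 [B14]),
TRAIN-N11 of CLAIM-BOARD (iii-b) (director-ym №343 (D5)∕(D6), №346 (3), №347, №348 (C): this seat holds items (11)(12)(9)); dag-n11-d g41's RUNBOOK `N11-S2-TRAIN-RUNBOOK.md` §4 (a) ∕ §5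
(«(8)(9)(10) are each ONE instantiation of §7.3»): keyed on dag-n11-w1's ✓p768576 `Thm/…N11BgRowGaugeLiftOfPowM` §3 `stage13_bgAtDatumBg_of_thm1RegSepCoP7MGB_of_thm1GaugeGB_of_powM` (the residue-free powM edition of dag-n11-d's (7) §7.3)
(`(Adm, bd, Dat)`-generic, background-generic, NO `PartCompat₁₃`) and node00-def-R's S2b ✓p766661 `Node00/LargeFieldBackgroundCoPOfRecordB` (`UbgMSCoPOfRecordB`, `ubgMSCoPOfRecordB_dichotomy`);
the `hseam` display is k0-s1-w1 g9's `Thm/…K0AllTorusOfStepTokensGuardedZBLam` §1 pattern (binder shape VERBATIM).  `--kind proof --supports stmt-QuantumFields-20541 --as helper` (count-neutral).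
THEOREMS ONLY (0 `def`).  [III] = [Balaban1988Convergent], [15] = [Balaban1985Variational], [6] = [Balaban1985RegularSpaces], [II] = [Balaban1984PropagatorsII], [I] = [Balaban1987RG1].

HONESTY GUARD (№338 (5)).  PURELY ADDITIVE print-datum twin of `…N11BgRowGaugeRAtCRLetteredMember` §1–§3 (FLAG №16 ∕ LOCATE-HSEAM 5d3298b8d191f169); the (b)-instances
(`bgSepCoPAt_ccmwCR_of_thm1GaugeR_of_hcomp_of_hjm`, `bgProvisoΛ_ccmwCR_…`, `bgFacts_ccmwCRH_…`) stay landed and true on their own text; nothing there is edited; no displayed premise is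
deleted or weakened — the (8)∕(9) sentences become the guarded `(bd, Dat)` sentences of S1a-C ∕ S1b-2 at `bd := lamDatum F`, the guard is the displayed row `hadm`, and the seam is
the displayed `hseam`.

WHY THIS FILE (the cR-lettered member `θ = θ₁₃(n_c, ε₂₉)`, `n_c := {θ₁₅ᶜᶜᴹᵂ(j; γ)'s numerics with s2.cR := c}`, `0 < c ≤ 8`, non-wrapping families `j + 1 ≤ F.m`).  §1 of the (b) file reads
the Stage-2 seam at ONE place — `rw [UbgOfRecord₁₃CoP_succ]` (:105) — and then applies (7)'s (b) guard-free engine `stage13_bgAtDatumCoP_…_of_hcubeΩ` over `UbgMSCoPOfRecord`.  After the seam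
edit (`UbgOfRecord₁₃CoP … (n+1) := UbgMSCoPOfRecordB …`) the row needs the background to BE a `Λ`-minimiser, which S2b's `UbgMSCoPOfRecordB` is TODAY (additive).  So this file proves
the guard-free row NOW over `UbgMSCoPOfRecordB`, displaying the seam as `hseam` (after the seam edit: `fun _ _ _ _ _ => UbgOfRecord₁₃CoP_succ …` applied; before it NOT provable and NOT
claimed).  ON THE GUARD-FREE ROAD (no `PartCompat₁₃` antecedent) the guard row `hadm` and the data transfer `hDat` are displayed in dag-n11-w1's `…BgRowGaugeSocketsGB` shapes, PartCompat-FREE (`hadm`: the guard at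
every window prefix; `hDat`: window-indexed — `id` at `Dat := dataSmall7PTopOf F N`; at print's `dataSmall7LamTopOf F N` it is dag-n11-w1's ✓p767961
`dataSmall7LamTopOf_of_dataSmall7PTop_of_powM θ rfl` — block saturation from `τ9.M = L^j` ALONE, no (C2): §4 `hDat_lam_ccmwCR` (v1.1; v1's «not available here» remark is WITHDRAWN)).
The CAMPAIGN in-place re-key of the (b) file's §1–§3 (same decl names, T3) is the SAME terms with `rw [UbgOfRecord₁₃CoP_succ]` for `rw [hseam]`.

WHAT THIS FILE PROVES (0 `def`, 0 `sorry`; `θ` any Stage-13 parameter EQUAL to the member, `hθ`; the (b) K0-door file's §1 letters `…_ccmwCR` BY NAME; dag-n11-w4's `hcubeΩ_of_powM`; A2ʷ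
`hsN_theta13OfThm1CCMW hjm`).
§1 ★ `bgAtDatumBg_ccmwCR_of_thm1GaugeGB_of_hcomp_of_hjm` — ROW P11 AT A STAGE-13 BACKGROUND `Ubg p n s 𝐖` AT THE MEMBER ON EVERY WINDOW RUN — NO RUN GUARD — `(Adm, bd, Dat)`-GENERIC,
   BACKGROUND-GENERIC (dichotomy `hbg` displayed), guard row `hadm` (n11-w1's window-prefix shape): dag-n11-w1's powM lift (v1.2; v1: (7) §7.3 with `hcube := hcubeΩ_of_powM`) at `M = L^j` with (C1) `hC1_ccmwCR`, `hsN` from `hjm`.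
§2 ★★ `bgSepCoPAt_ccmwCR_of_thm1GaugeGB_of_hcomp_of_hjm_lam` — the (b) file's §1 SHAPE (`W ∈ suppOfRecord₁₃P`, `Sect2.DataSmall7PTop`, background `UbgOfRecord₁₃CoP` BY NAME, NO
   `PartCompat₁₃`) from (8)ᴮ∕(9)ᴮ at `(Adm, lamDatum F, Dat)` + `hadm` + `hDat` + `hseam` + (hcomp) ∧ (hcompRev): §1 at `Ubg := UbgMSCoPOfRecordB`, `hbg := ubgMSCoPOfRecordB_dichotomy`, `rw [hseam]`.
§3 ★★ `bgProvisoΛ_ccmwCR_of_thm1GaugeGB_of_hcomp_of_hjm_lam` — ROW P11 IN ITS OWN CURRENCY `BgProvisoΛ … (suppOfRecord₁₃SepCoP …) (UbgOfRecord₁₃CoP …)` on every window run (K0a's support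
   adapter, as the (b) file's §2) · ★★ `bgFacts_ccmwCRH_of_thm1GaugeGB_of_hcomp_of_hjm_lam` — the `hbgs` binder of dag-n11-w1's `…OfBgFacts` consumers at every H-extension, every window
   `γ' ≤ θ.γ` (as the (b) file's §3).
§4 (v1.1) `hDat_lam_ccmwCR` — the transfer `hDat` DISCHARGED at the member at print's clause `Dat := dataSmall7LamTopOf F N` (dag-n11-w1's ✓p767961 `dataSmall7LamTopOf_of_dataSmall7PTop_of_powM`,
   `τ9.M = L^j` by `rfl`), `hadm_floorGuard_ccmwCR` (the guard row at the legacy floor guard IS `hc₁₅`), and §3's `hbgs` binder at print's clause with `hDat` gone.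

v1.2 — RESIDUE-FREE RE-POINT (director-ym №365 RENAME-AND-REDIRECT; CLASS-S shape: imports + `open` + proof tokens only, EVERY STATEMENT BYTE-IDENTICAL): the member's letters now come
from this seat's `Thm/…N11CRLetteredMemberLetters` bundle, the lift from dag-n11-w1's ✓p768576 `…BgRowGaugeLiftOfPowM` (powM edition of dag-n11-d's §7.3: `hcube` discharged inside from `τ9.M = L^j` + (C1)), `hcubeΩ_of_powM` from `…BgRowOfPowM` — this file no longer imports the
Stage-2 residue module `…N11BgRowGaugeRAtCRLetteredMember` (nor, through it, (7)∕(11)), so it stays GREEN after the seam.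

HONEST FRAMING ∕ A6.  Helper lane, count-neutral KERNEL BOOKKEEPING (applications BY NAME of dag-n11-d's ∕ k0-s1-w1's ∕ node00-def-R's engines + the member's arithmetic letters);
CONDITIONAL on `hseam` (the Stage-2 seam — NOT in the tree at filing time), `hDat`, `hadm`, the two ᴮ [15] sentences (K0⁷'s stub territory — CANDIDATE texts, V23 NOT registered) and
(hcomp) ∧ (hcompRev), all DISPLAYED, never asserted; nothing of Bałaban ([III] ∕ [15] ∕ [6] ∕ [I]) asserted or discharged; NOT a re-pin (no `def`).  K0⁷ stub 1 NOT closed; N11 NOT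
discharged; K1⁹ NOT closed; counts unmoved (typed 28∕28 · discharged 8∕27 · A 8∕28) · K 1∕4.  One finite `𝕋⁴_{L^K}` programme at fixed `ε = L^{−K}`; `route-QuantumFields-BalabanUVNodes`
closes ONLY the CONDITIONAL finite-𝕋⁴ rung `BalabanLadder.UV` — NOT ℝ⁴, NOT OS, NOT the Yang–Mills mass gap (Clay).  No `sorry`, no `axiom`, no `def`, no `instance`, no `notation`.
Sources (SHAPE only): [III] Thm 1 p.262, (2.1) p.254, (2.3)–(2.8) pp.255–256, (2.10) p.256, (2.12)–(2.13) pp.256–257, (2.18) p.257, (2.25)–(2.28) pp.258–259, (2.34)–(2.41) p.261;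
[15] (6)–(7) p.278, Thm 1 (8)–(9) p.279, (144)–(152) pp.300–301, Prop. 8 p.304; [6] (1.3)–(1.9) p.77; [II] (2.3) p.224; [I] Thm 1 p.259, (0.1) p.251, (1.11)–(1.16) p.262.
-/

noncomputable section

open MeasureTheory
open scoped Matrix.Norms.L2Operator

namespace Summit.QuantumFields.YangMills.Theorems.BalabanUVNodesN11BgRowGaugeRAtCRLetteredMemberB

open Literature.MathematicalPhysics.QuantumFieldTheory.Balaban1983to89 Node00
open T4Continuum B14.Eq218Concrete B15DeterminingSets B15DeterminingSetsB FlowStep FlowStepRuns B12RegularSpaces111 B14RegularSpaces234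
open BalabanUVNodesN11BgRowGaugeLiftOfPowM (stage13_bgAtDatumBg_of_thm1RegSepCoP7MGB_of_thm1GaugeGB_of_powM)
open BalabanUVNodesN11CRLetteredMemberLetters (letters_ccmwCR hC1_letter_ccmwCR)

variable {F : T4Family} {N : ℕ} [NeZero N] {j : ℕ} {γ c ε₀ ε₂₉ B₃ B₃' a₀ a₁ : ℝ} {θ : Stage13Params F N} {Adm : StepGuard F} {bd : BondDatum F} {Dat : TopData F N}

/-! ## §1  ★ Row P11 at a Stage-13 background AT THE MEMBER on every window run — no run guard, `(Adm, bd, Dat)`-generic, background-generic -/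

/-- **★ ROW P11 AT A STAGE-13 BACKGROUND `Ubg p n s 𝐖` AT THE cR-LETTERED MEMBER ON EVERY WINDOW RUN — NO RUN GUARD** (`0 < c ≤ 8`, `0 < γ ≤ ½`, non-wrapping families `j + 1 ≤ F.m`),
FROM THE GUARDED `(bd, Dat)` SENTENCES (8) `VariationalThm1RegSepCoP7MGB … Adm bd Dat …` (S1a-C) AND (9) `VariationalThm1GaugeRegSepCoP7MGB … (L^j) Adm bd Dat …` (S1b-2), the guard discharge
`hadm` (the guard at every window prefix — dag-n11-w1's `…SocketsGB` shape, PartCompat-FREE), the background's `bd`-spec dichotomy `hbg`, and (hcomp) ∧ (hcompRev): dag-n11-d's (7) §7.3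
`stage13_bgAtDatumBg_of_thm1RegSepCoP7MGB_of_thm1GaugeGB_of_hcubeΩ` AT THE MEMBER with the (b) door file's §1 letters, `hcube := hcubeΩ_of_powM` at `M = L^j` (`rfl`) fed by (C1) `hC1_ccmwCR`,
and `hsN := hsN_theta13OfThm1CCMW hjm` (the member's `τ9` is θ₁₅ᶜᶜᴹᵂ's); at `n = 0` the window of scales is empty.  CONDITIONAL on the two `Prop`s (hypotheses); nothing of Bałaban asserted.
[cite: Balaban1985Variational, (6)–(7) p.278, Thm 1 (8)–(9) p.279, (144)–(152) pp.300–301, Prop. 8 p.304, p.304 lines 1–2; Balaban1985RegularSpaces, (1.3)–(1.9) p.77; Balaban1984PropagatorsII, (2.3) p.224; Balaban1988Convergent, Thm 1 p.262, (2.1) p.254, (2.4)–(2.8) pp.255–256, (2.10) p.256, (2.12)–(2.13) pp.256–257, (2.18) p.257, (2.25)–(2.28) pp.258–259; Balaban1987RG1, Thm 1 p.259, (0.1) p.251, (1.12) p.262] -/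
theorem bgAtDatumBg_ccmwCR_of_thm1GaugeGB_of_hcomp_of_hjm (hθ : θ = theta13LiveOfNumerics F N
      ({ stage12NumericsOfThm1CCMW F.L j γ ε₀ B₃ B₃' a₀ a₁ with s2 := { sect2NumericsOfThm1C F.L with cR := c } } : Stage12Numerics) ε₂₉
      (zeta316OfRecord F N (stage12NumericsOfThm1CCMW F.L j γ ε₀ B₃ B₃' a₀ a₁).ν (stage12NumericsOfThm1CCMW F.L j γ ε₀ B₃ B₃' a₀ a₁).τ9.M
        (stage12NumericsOfThm1CCMW F.L j γ ε₀ B₃ B₃' a₀ a₁).A₁) (RzOfRecord F N) (ZtOfRecord F N))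
    (hjm : j + 1 ≤ F.m) (hc0 : 0 < c) (hc8 : c ≤ 8) (hγ0 : 0 < γ) (hγ : γ ≤ 1 / 2) (hε : 0 < ε₀) (hε' : 0 < ε₂₉) (hB : 0 ≤ B₃) (hB' : 0 ≤ B₃') (ha₀ : 0 < a₀) (ha₁ : 0 < a₁)
    (h15 : VariationalThm1RegSepCoP7MGB F N Adm bd Dat B₃ a₀ a₁) (h15G : VariationalThm1GaugeRegSepCoP7MGB F N (F.L ^ j) Adm bd Dat B₃ B₃' a₀ a₁)
    (hadm : ∀ (p : B12.RunParams) (n : ℕ), n ≤ p.K → Step.InInterval θ.γ n (gOfRecord₁₃ F N θ p) →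
      ∀ s : SeqOfRecord F θ.ν θ.τ9.M (gOfRecord₁₃ F N θ p) p.K n, Adm θ.ν θ.τ9.M (gOfRecord₁₃ F N θ p) p.K n s)
    (Ubg : (p : B12.RunParams) → (n : ℕ) → SeqOfRecord F θ.ν θ.τ9.M (gOfRecord₁₃ F N θ p) p.K n → MSField (F.P p.K) (SU N) → GaugeField (F.P p.K) 0 (SU N))
    (hbg : ∀ (p : B12.RunParams) (n : ℕ) (s : SeqOfRecord F θ.ν θ.τ9.M (gOfRecord₁₃ F N θ p) p.K n) (W : MSField (F.P p.K) (SU N)),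
      IsMinimizerB (avOfRecord F N p.K) (regMSCoPOfRecord F N θ.ν p.K n s.Ω) (bd p.K n s.Ω) W (Ubg p n s W) ∨ Ubg p n s W = 1)
    (hcomp : ∀ (p : B12.RunParams) (n : ℕ), n ≤ p.K → Step.InInterval θ.γ n (gOfRecord₁₃ F N θ p) → ∀ m, m < n →
      θ.s2.cR * epsOfRecord θ.ν (gOfRecord₁₃ F N θ p) m ≤ 2 * (θ.s2.cR * epsOfRecord θ.ν (gOfRecord₁₃ F N θ p) (m + 1)))
    (hcompRev : ∀ (p : B12.RunParams) (n : ℕ), n ≤ p.K → Step.InInterval θ.γ n (gOfRecord₁₃ F N θ p) → ∀ m, m < n →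
      θ.s2.cR * epsOfRecord θ.ν (gOfRecord₁₃ F N θ p) (m + 1) ≤ 2 * (θ.s2.cR * epsOfRecord θ.ν (gOfRecord₁₃ F N θ p) m)) :
    ∀ (p : B12.RunParams) (n : ℕ), n ≤ p.K → Step.InInterval θ.γ n (gOfRecord₁₃ F N θ p) →
      ∀ s : SeqOfRecord F θ.ν θ.τ9.M (gOfRecord₁₃ F N θ p) p.K n, Sect2.SeqSeparated θ.ν.M₁ s → ∀ W : MSField (F.P p.K) (SU N),
      Dat p.K s.Ω (suppDomOfRecord F θ.ν p.K s.Ω) n (fun j' => θ.s2.cR * epsOfRecord θ.ν (gOfRecord₁₃ F N θ p) j') W →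
      ∀ j', 1 ≤ j' → j' ≤ n → ∀ X : (Sect2.domSys (F.P p.K) θ.τ9.M j').Dom,
      (Sect2.domSites (F.P p.K) θ.τ9.M j' X ⊆ s.Λ j' →
        Sect2.ofBackgroundC (settingOfRecord₁₃ F N θ p).ι (Ubg p n s W) ∈
          Sect2.spaceI (settingOfRecord₁₃ F N θ p) (θ.Rz p.K) θ.τ9.M j' (Sect2.domSites (F.P p.K) θ.τ9.M j' X)
            ((settingOfRecord₁₃ F N θ p).lf.alpha0 ((settingOfRecord₁₃ F N θ p).flow.g j')) ((settingOfRecord₁₃ F N θ p).lf.alpha1 ((settingOfRecord₁₃ F N θ p).flow.g j'))) ∧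
      (Sect2.admB (F.P p.K) θ.ν θ.τ9.M (gOfRecord₁₃ F N θ p) s.Ω s.Λ j' (Sect2.domSites (F.P p.K) θ.τ9.M j' X) = true →
        Sect2.ofBackgroundC (settingOfRecord₁₃ F N θ p).ι (Ubg p n s W) ∈
          Sect2.spaceMS (settingOfRecord₁₃ F N θ p) (θ.Rz p.K) θ.τ9.M j' (Sect2.domSites (F.P p.K) θ.τ9.M j' X) s.Ω) := by
  obtain ⟨hnum, hεreg, hBα, htI, htMS, hC1, -, -, -, -⟩ := letters_ccmwCR hθ hc0 hc8 hγ hB hB' ha₀ ha₁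
  subst hθ
  -- the no-wrap letter from the family letter `j + 1 ≤ F.m` (the member's `M` is θ₁₅ᶜᶜᴹᵂ's `L^j`)
  have hsN := hsN_theta13OfThm1CCMW F N γ ε₀ ε₂₉ B₃ B₃' a₀ a₁ hjm
  have hγ1 : γ < 1 := hγ.trans_lt (by norm_num)
  have hpos : ({ stage12NumericsOfThm1CCMW F.L j γ ε₀ B₃ B₃' a₀ a₁ with s2 := { sect2NumericsOfThm1C F.L with cR := c } } : Stage12Numerics).Pos := by
    obtain ⟨h1, h2, h3, h4, h5, h6, -, h8, h9⟩ := stage12NumericsOfThm1CCMW_pos (j := j) F.hL.2.le hγ0 hγ1 hε hB hB' ha₀ ha₁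
    exact ⟨h1, h2, h3, h4, h5, h6, hc0, h8, h9⟩
  have hθadm := (admissible_theta13OfNumerics
    (n := ({ stage12NumericsOfThm1CCMW F.L j γ ε₀ B₃ B₃' a₀ a₁ with s2 := { sect2NumericsOfThm1C F.L with cR := c } } : Stage12Numerics)) F N
    (zeta316OfRecord F N (stage12NumericsOfThm1CCMW F.L j γ ε₀ B₃ B₃' a₀ a₁).ν (stage12NumericsOfThm1CCMW F.L j γ ε₀ B₃ B₃' a₀ a₁).τ9.M
      (stage12NumericsOfThm1CCMW F.L j γ ε₀ B₃ B₃' a₀ a₁).A₁) (RzOfRecord F N) (ZtOfRecord F N) hpos hε').liveRepin₁₃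
  intro p n hn hw s hsep W h7
  cases n with
  | zero => intro j' h1 hj'; exfalso; omega
  | succ n =>
    exact stage13_bgAtDatumBg_of_thm1RegSepCoP7MGB_of_thm1GaugeGB_of_powM _ hθadm rfl h15 h15G Ubg hbg hnum hεreg hcomp hcompRev hBα htI htMS (a := j) rfl hC1 hsN
      p (n + 1) hn hw s hsep (show 0 < F.L ^ j from pow_pos (by have := F.hL11; omega) _) (hadm p (n + 1) hn hw s) W h7

/-! ## §2  ★★ The (b) file's §1 shape AT THE MEMBER over print's datum: `UbgMSCoPOfRecordB` ∘ `hseam`, data transfer `hDat` -/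

/-- **★★ THE (7)-GUARDED SEPARATED ROW P11 AT THE Co CARRIER AT THE cR-LETTERED MEMBER ON EVERY WINDOW RUN — NO RUN GUARD — IN THE (b) FILE's §1 SHAPE** (`W ∈ suppOfRecord₁₃P`,
`Sect2.DataSmall7PTop`, background `UbgOfRecord₁₃CoP` BY NAME) **FROM (8)ᴮ `VariationalThm1RegSepCoP7MGB F N Adm (lamDatum F) Dat`, (9)ᴮ `VariationalThm1GaugeRegSepCoP7MGB F N (L^j) Adm
(lamDatum F) Dat`, `hadm`, `hDat` (dag-n11-w1's window-indexed shapes, PartCompat-FREE), `hseam`, AND (hcomp) ∧ (hcompRev)**, `0 < c ≤ 8`, `0 < γ ≤ ½`, `j + 1 ≤ F.m`: §1 at `Ubg := UbgMSCoPOfRecordB …`, `bd := lamDatum F`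
(`= lamBondsSeq`, `rfl`), `hbg := ubgMSCoPOfRecordB_dichotomy` (S2b), data by `hDat`, then `rw [hseam]`; at `n = 0` the window of scales is empty.  Statement = the (b) file's §1 with the two (b)
sentences (and the floor `hc₁₅`) replaced and `hadm ∕ hDat ∕ hseam` added.  CONDITIONAL; nothing of Bałaban asserted; `hseam` NOT provable before the seam edit and NOT claimed.
[cite: Balaban1985Variational, (6)–(7) p.278, Thm 1 (8)–(9) p.279, (144)–(152) pp.300–301, Prop. 8 p.304; Balaban1985RegularSpaces, (1.3)–(1.9) p.77; Balaban1984PropagatorsII, (2.3) p.224; Balaban1988Convergent, Thm 1 p.262, (2.1) p.254, (2.4)–(2.8) pp.255–256, (2.10) p.256, (2.12)–(2.13) pp.256–257, (2.18) p.257, (2.25)–(2.28) pp.258–259; Balaban1987RG1, Thm 1 p.259, (0.1) p.251, (1.12) p.262] -/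
theorem bgSepCoPAt_ccmwCR_of_thm1GaugeGB_of_hcomp_of_hjm_lam (hθ : θ = theta13LiveOfNumerics F N
      ({ stage12NumericsOfThm1CCMW F.L j γ ε₀ B₃ B₃' a₀ a₁ with s2 := { sect2NumericsOfThm1C F.L with cR := c } } : Stage12Numerics) ε₂₉
      (zeta316OfRecord F N (stage12NumericsOfThm1CCMW F.L j γ ε₀ B₃ B₃' a₀ a₁).ν (stage12NumericsOfThm1CCMW F.L j γ ε₀ B₃ B₃' a₀ a₁).τ9.M
        (stage12NumericsOfThm1CCMW F.L j γ ε₀ B₃ B₃' a₀ a₁).A₁) (RzOfRecord F N) (ZtOfRecord F N))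
    (hjm : j + 1 ≤ F.m) (hc0 : 0 < c) (hc8 : c ≤ 8) (hγ0 : 0 < γ) (hγ : γ ≤ 1 / 2) (hε : 0 < ε₀) (hε' : 0 < ε₂₉) (hB : 0 ≤ B₃) (hB' : 0 ≤ B₃') (ha₀ : 0 < a₀) (ha₁ : 0 < a₁)
    (h15 : VariationalThm1RegSepCoP7MGB F N Adm (lamDatum F) Dat B₃ a₀ a₁) (h15G : VariationalThm1GaugeRegSepCoP7MGB F N (F.L ^ j) Adm (lamDatum F) Dat B₃ B₃' a₀ a₁)
    (hadm : ∀ (p : B12.RunParams) (n : ℕ), n ≤ p.K → Step.InInterval θ.γ n (gOfRecord₁₃ F N θ p) →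
      ∀ s : SeqOfRecord F θ.ν θ.τ9.M (gOfRecord₁₃ F N θ p) p.K n, Adm θ.ν θ.τ9.M (gOfRecord₁₃ F N θ p) p.K n s)
    (hDat : ∀ (p : B12.RunParams) (n : ℕ) (s : SeqOfRecord F θ.ν θ.τ9.M (gOfRecord₁₃ F N θ p) p.K n) (δ : ℕ → ℝ) (W : MSField (F.P p.K) (SU N)),
      n ≤ p.K → Step.InInterval θ.γ n (gOfRecord₁₃ F N θ p) →
      Sect2.DataSmall7PTop (avOfRecord F N p.K) s.Ω (suppDomOfRecord F θ.ν p.K s.Ω) n δ W → Dat p.K s.Ω (suppDomOfRecord F θ.ν p.K s.Ω) n δ W)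
    (hseam : ∀ (θ' : Stage13Params F N) (p : B12.RunParams) (n : ℕ) (s : SeqOfRecord F θ'.ν θ'.τ9.M (gOfRecord₁₃ F N θ' p) p.K (n + 1)) (W : MSField (F.P p.K) (SU N)),
      UbgOfRecord₁₃CoP F N θ' p (n + 1) s W = UbgMSCoPOfRecordB F N θ'.ν θ'.τ9.M (gOfRecord₁₃ F N θ' p) p.K (n + 1) s W)
    (hcomp : ∀ (p : B12.RunParams) (n : ℕ), n ≤ p.K → Step.InInterval θ.γ n (gOfRecord₁₃ F N θ p) → ∀ m, m < n →
      θ.s2.cR * epsOfRecord θ.ν (gOfRecord₁₃ F N θ p) m ≤ 2 * (θ.s2.cR * epsOfRecord θ.ν (gOfRecord₁₃ F N θ p) (m + 1)))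
    (hcompRev : ∀ (p : B12.RunParams) (n : ℕ), n ≤ p.K → Step.InInterval θ.γ n (gOfRecord₁₃ F N θ p) → ∀ m, m < n →
      θ.s2.cR * epsOfRecord θ.ν (gOfRecord₁₃ F N θ p) (m + 1) ≤ 2 * (θ.s2.cR * epsOfRecord θ.ν (gOfRecord₁₃ F N θ p) m)) :
    ∀ (p : B12.RunParams) (n : ℕ), n ≤ p.K → Step.InInterval θ.γ n (gOfRecord₁₃ F N θ p) →
      ∀ s : SeqOfRecord F θ.ν θ.τ9.M (gOfRecord₁₃ F N θ p) p.K n, Sect2.SeqSeparated θ.ν.M₁ s →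
      ∀ W : MSField (F.P p.K) (SU N), W ∈ suppOfRecord₁₃P F N θ p n s →
      Sect2.DataSmall7PTop (avOfRecord F N p.K) s.Ω (suppDomOfRecord F θ.ν p.K s.Ω) n (fun j' => θ.s2.cR * epsOfRecord θ.ν (gOfRecord₁₃ F N θ p) j') W →
      ∀ j', 1 ≤ j' → j' ≤ n → ∀ X : (Sect2.domSys (F.P p.K) θ.τ9.M j').Dom,
      (Sect2.domSites (F.P p.K) θ.τ9.M j' X ⊆ s.Λ j' →
        Sect2.ofBackgroundC (settingOfRecord₁₃ F N θ p).ι (UbgOfRecord₁₃CoP F N θ p n s W) ∈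
          Sect2.spaceI (settingOfRecord₁₃ F N θ p) (θ.Rz p.K) θ.τ9.M j' (Sect2.domSites (F.P p.K) θ.τ9.M j' X)
            ((settingOfRecord₁₃ F N θ p).lf.alpha0 ((settingOfRecord₁₃ F N θ p).flow.g j')) ((settingOfRecord₁₃ F N θ p).lf.alpha1 ((settingOfRecord₁₃ F N θ p).flow.g j'))) ∧
      (Sect2.admB (F.P p.K) θ.ν θ.τ9.M (gOfRecord₁₃ F N θ p) s.Ω s.Λ j' (Sect2.domSites (F.P p.K) θ.τ9.M j' X) = true →
        Sect2.ofBackgroundC (settingOfRecord₁₃ F N θ p).ι (UbgOfRecord₁₃CoP F N θ p n s W) ∈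
          Sect2.spaceMS (settingOfRecord₁₃ F N θ p) (θ.Rz p.K) θ.τ9.M j' (Sect2.domSites (F.P p.K) θ.τ9.M j' X) s.Ω) := by
  have H := bgAtDatumBg_ccmwCR_of_thm1GaugeGB_of_hcomp_of_hjm hθ hjm hc0 hc8 hγ0 hγ hε hε' hB hB' ha₀ ha₁ h15 h15G hadm
    (fun p n s W => UbgMSCoPOfRecordB F N θ.ν θ.τ9.M (gOfRecord₁₃ F N θ p) p.K n s W)
    (fun p n s W => ubgMSCoPOfRecordB_dichotomy θ.ν θ.τ9.M (gOfRecord₁₃ F N θ p) p.K n s W) hcomp hcompRev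
  intro p n hn hw s hsep W _ h7
  cases n with
  | zero => intro j' h1 hj'; exfalso; omega
  | succ n =>
    rw [hseam]
    exact H p (n + 1) hn hw s hsep W (hDat p (n + 1) s _ W hn hw h7)

/-! ## §3  ★★ Row P11 in its own currency on every window run, and the `hbgs` binder at every H-extension -/

/-- **★★ ROW P11 IN ITS OWN CURRENCY AT THE MEMBER ON EVERY WINDOW RUN — NO RUN GUARD — OVER PRINT'S DATUM**: `BgProvisoΛ … n (suppOfRecord₁₃SepCoP …) (UbgOfRecord₁₃CoP …)` (the TYPE of
`Provisos₁₃SepCoPH.bg`'s consequent) from §2 through K0a's support adapter (`suppOfRecord₁₃SepCoP` membership = ⟨`suppOfRecord₁₃P`, separation, (7)⟩) — the (b) file's §2 over the ᴮ tokens,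
`hadm`, `hDat`, `hseam`.  CONDITIONAL; nothing of Bałaban asserted.
[cite: Balaban1988Convergent, (2.28) p.259, (2.18) p.257, Thm 1 p.262; Balaban1985Variational, (6)–(7) p.278, Thm 1 (8)–(9) p.279; Balaban1985RegularSpaces, (1.3)–(1.6) p.77; Balaban1984PropagatorsII, (2.3) p.224] -/
theorem bgProvisoΛ_ccmwCR_of_thm1GaugeGB_of_hcomp_of_hjm_lam (hθ : θ = theta13LiveOfNumerics F N
      ({ stage12NumericsOfThm1CCMW F.L j γ ε₀ B₃ B₃' a₀ a₁ with s2 := { sect2NumericsOfThm1C F.L with cR := c } } : Stage12Numerics) ε₂₉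
      (zeta316OfRecord F N (stage12NumericsOfThm1CCMW F.L j γ ε₀ B₃ B₃' a₀ a₁).ν (stage12NumericsOfThm1CCMW F.L j γ ε₀ B₃ B₃' a₀ a₁).τ9.M
        (stage12NumericsOfThm1CCMW F.L j γ ε₀ B₃ B₃' a₀ a₁).A₁) (RzOfRecord F N) (ZtOfRecord F N))
    (hjm : j + 1 ≤ F.m) (hc0 : 0 < c) (hc8 : c ≤ 8) (hγ0 : 0 < γ) (hγ : γ ≤ 1 / 2) (hε : 0 < ε₀) (hε' : 0 < ε₂₉) (hB : 0 ≤ B₃) (hB' : 0 ≤ B₃') (ha₀ : 0 < a₀) (ha₁ : 0 < a₁)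
    (h15 : VariationalThm1RegSepCoP7MGB F N Adm (lamDatum F) Dat B₃ a₀ a₁) (h15G : VariationalThm1GaugeRegSepCoP7MGB F N (F.L ^ j) Adm (lamDatum F) Dat B₃ B₃' a₀ a₁)
    (hadm : ∀ (p : B12.RunParams) (n : ℕ), n ≤ p.K → Step.InInterval θ.γ n (gOfRecord₁₃ F N θ p) →
      ∀ s : SeqOfRecord F θ.ν θ.τ9.M (gOfRecord₁₃ F N θ p) p.K n, Adm θ.ν θ.τ9.M (gOfRecord₁₃ F N θ p) p.K n s)
    (hDat : ∀ (p : B12.RunParams) (n : ℕ) (s : SeqOfRecord F θ.ν θ.τ9.M (gOfRecord₁₃ F N θ p) p.K n) (δ : ℕ → ℝ) (W : MSField (F.P p.K) (SU N)),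
      n ≤ p.K → Step.InInterval θ.γ n (gOfRecord₁₃ F N θ p) →
      Sect2.DataSmall7PTop (avOfRecord F N p.K) s.Ω (suppDomOfRecord F θ.ν p.K s.Ω) n δ W → Dat p.K s.Ω (suppDomOfRecord F θ.ν p.K s.Ω) n δ W)
    (hseam : ∀ (θ' : Stage13Params F N) (p : B12.RunParams) (n : ℕ) (s : SeqOfRecord F θ'.ν θ'.τ9.M (gOfRecord₁₃ F N θ' p) p.K (n + 1)) (W : MSField (F.P p.K) (SU N)),
      UbgOfRecord₁₃CoP F N θ' p (n + 1) s W = UbgMSCoPOfRecordB F N θ'.ν θ'.τ9.M (gOfRecord₁₃ F N θ' p) p.K (n + 1) s W)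
    (hcomp : ∀ (p : B12.RunParams) (n : ℕ), n ≤ p.K → Step.InInterval θ.γ n (gOfRecord₁₃ F N θ p) → ∀ m, m < n →
      θ.s2.cR * epsOfRecord θ.ν (gOfRecord₁₃ F N θ p) m ≤ 2 * (θ.s2.cR * epsOfRecord θ.ν (gOfRecord₁₃ F N θ p) (m + 1)))
    (hcompRev : ∀ (p : B12.RunParams) (n : ℕ), n ≤ p.K → Step.InInterval θ.γ n (gOfRecord₁₃ F N θ p) → ∀ m, m < n →
      θ.s2.cR * epsOfRecord θ.ν (gOfRecord₁₃ F N θ p) (m + 1) ≤ 2 * (θ.s2.cR * epsOfRecord θ.ν (gOfRecord₁₃ F N θ p) m)) :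
    ∀ (p : B12.RunParams) (n : ℕ), n ≤ p.K → Step.InInterval θ.γ n (gOfRecord₁₃ F N θ p) →
      BgProvisoΛ F N p.K (settingOfRecord₁₃ F N θ p) (θ.Rz p.K) θ.τ9.M n (suppOfRecord₁₃SepCoP F N θ p n) (UbgOfRecord₁₃CoP F N θ p n) := by
  intro p n hn hw s W hW
  exact bgSepCoPAt_ccmwCR_of_thm1GaugeGB_of_hcomp_of_hjm_lam hθ hjm hc0 hc8 hγ0 hγ hε hε' hB hB' ha₀ ha₁ h15 h15G hadm hDat hseam hcomp hcompRev
    p n hn hw s hW.2.1 W hW.1 hW.2.2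

/-- **★★ THE `hbgs` BINDER OF dag-n11-w1's `…OfBgFacts` CONSUMERS, AT EVERY H-EXTENSION OF THE MEMBER, FOR EVERY WINDOW `γ' ≤ θ.γ`, OVER PRINT'S DATUM**: per run in `]0, γ']` up to `K`, the
bg facts at EVERY length `k ≤ K` — NO run guard (window monotonicity in the length); the (b) file's §3 over the ᴮ tokens, `hadm`, `hDat`, `hseam`.
[cite: Balaban1988Convergent, (2.28) p.259, Thm 1 p.262 (bookkeeping); Balaban1984PropagatorsII, (2.3) p.224] -/
theorem bgFacts_ccmwCRH_of_thm1GaugeGB_of_hcomp_of_hjm_lam {θH : Stage13HParams F N} (hH : θH.toStage13Params = θ) (hθ : θ = theta13LiveOfNumerics F N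
      ({ stage12NumericsOfThm1CCMW F.L j γ ε₀ B₃ B₃' a₀ a₁ with s2 := { sect2NumericsOfThm1C F.L with cR := c } } : Stage12Numerics) ε₂₉
      (zeta316OfRecord F N (stage12NumericsOfThm1CCMW F.L j γ ε₀ B₃ B₃' a₀ a₁).ν (stage12NumericsOfThm1CCMW F.L j γ ε₀ B₃ B₃' a₀ a₁).τ9.M
        (stage12NumericsOfThm1CCMW F.L j γ ε₀ B₃ B₃' a₀ a₁).A₁) (RzOfRecord F N) (ZtOfRecord F N))
    (hjm : j + 1 ≤ F.m) (hc0 : 0 < c) (hc8 : c ≤ 8) (hγ0 : 0 < γ) (hγ : γ ≤ 1 / 2) (hε : 0 < ε₀) (hε' : 0 < ε₂₉) (hB : 0 ≤ B₃) (hB' : 0 ≤ B₃') (ha₀ : 0 < a₀) (ha₁ : 0 < a₁)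
    (h15 : VariationalThm1RegSepCoP7MGB F N Adm (lamDatum F) Dat B₃ a₀ a₁) (h15G : VariationalThm1GaugeRegSepCoP7MGB F N (F.L ^ j) Adm (lamDatum F) Dat B₃ B₃' a₀ a₁)
    (hadm : ∀ (p : B12.RunParams) (n : ℕ), n ≤ p.K → Step.InInterval θ.γ n (gOfRecord₁₃ F N θ p) →
      ∀ s : SeqOfRecord F θ.ν θ.τ9.M (gOfRecord₁₃ F N θ p) p.K n, Adm θ.ν θ.τ9.M (gOfRecord₁₃ F N θ p) p.K n s)
    (hDat : ∀ (p : B12.RunParams) (n : ℕ) (s : SeqOfRecord F θ.ν θ.τ9.M (gOfRecord₁₃ F N θ p) p.K n) (δ : ℕ → ℝ) (W : MSField (F.P p.K) (SU N)),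
      n ≤ p.K → Step.InInterval θ.γ n (gOfRecord₁₃ F N θ p) →
      Sect2.DataSmall7PTop (avOfRecord F N p.K) s.Ω (suppDomOfRecord F θ.ν p.K s.Ω) n δ W → Dat p.K s.Ω (suppDomOfRecord F θ.ν p.K s.Ω) n δ W)
    (hseam : ∀ (θ' : Stage13Params F N) (p : B12.RunParams) (n : ℕ) (s : SeqOfRecord F θ'.ν θ'.τ9.M (gOfRecord₁₃ F N θ' p) p.K (n + 1)) (W : MSField (F.P p.K) (SU N)),
      UbgOfRecord₁₃CoP F N θ' p (n + 1) s W = UbgMSCoPOfRecordB F N θ'.ν θ'.τ9.M (gOfRecord₁₃ F N θ' p) p.K (n + 1) s W)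
    (hcomp : ∀ (p : B12.RunParams) (n : ℕ), n ≤ p.K → Step.InInterval θ.γ n (gOfRecord₁₃ F N θ p) → ∀ m, m < n →
      θ.s2.cR * epsOfRecord θ.ν (gOfRecord₁₃ F N θ p) m ≤ 2 * (θ.s2.cR * epsOfRecord θ.ν (gOfRecord₁₃ F N θ p) (m + 1)))
    (hcompRev : ∀ (p : B12.RunParams) (n : ℕ), n ≤ p.K → Step.InInterval θ.γ n (gOfRecord₁₃ F N θ p) → ∀ m, m < n →
      θ.s2.cR * epsOfRecord θ.ν (gOfRecord₁₃ F N θ p) (m + 1) ≤ 2 * (θ.s2.cR * epsOfRecord θ.ν (gOfRecord₁₃ F N θ p) m)) {γ' : ℝ} (hγ' : γ' ≤ θ.γ) :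
    ∀ P : B12.RunParams, Step.InInterval γ' P.K (gOfRecord₁₃ F N θH.toStage13Params P) → ∀ k, k ≤ P.K →
      BgProvisoΛ F N P.K (settingOfRecord₁₃ F N θH.toStage13Params P) (θH.Rz P.K) θH.τ9.M k (suppOfRecord₁₃SepCoP F N θH.toStage13Params P k)
        (UbgOfRecord₁₃CoP F N θH.toStage13Params P k) := by
  subst hH
  intro P hw k hk
  exact bgProvisoΛ_ccmwCR_of_thm1GaugeGB_of_hcomp_of_hjm_lam hθ hjm hc0 hc8 hγ0 hγ hε hε' hB hB' ha₀ ha₁ h15 h15G hadm hDat hseam hcomp hcompRev P k hk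
    (fun m hm => ⟨(hw m (hm.trans hk)).1, (hw m (hm.trans hk)).2.trans hγ'⟩)


/-! ## §4  (v1.1) The transfer `hDat` DISCHARGED at print's clause, and the `hbgs` binder there -/

/-- **(v1.1) `hDat` AT THE MEMBER AT PRINT'S DATA CLAUSE `Dat := dataSmall7LamTopOf F N`** — dag-n11-w1's ✓p767961 `dataSmall7LamTopOf_of_dataSmall7PTop_of_powM` (block saturation of the
regions of record from `τ9.M = L^a` alone, NO run guard, NO (C2)) at the member (`τ9.M = L^j`, `rfl`).  Pure bookkeeping. [cite: Balaban1985Variational, (3),(7) p.278; Balaban1984PropagatorsII, (2.3) p.224; Balaban1988Convergent, (2.1) p.254, (2.18) p.257] -/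
theorem hDat_lam_ccmwCR (hθ : θ = theta13LiveOfNumerics F N
      ({ stage12NumericsOfThm1CCMW F.L j γ ε₀ B₃ B₃' a₀ a₁ with s2 := { sect2NumericsOfThm1C F.L with cR := c } } : Stage12Numerics) ε₂₉
      (zeta316OfRecord F N (stage12NumericsOfThm1CCMW F.L j γ ε₀ B₃ B₃' a₀ a₁).ν (stage12NumericsOfThm1CCMW F.L j γ ε₀ B₃ B₃' a₀ a₁).τ9.M
        (stage12NumericsOfThm1CCMW F.L j γ ε₀ B₃ B₃' a₀ a₁).A₁) (RzOfRecord F N) (ZtOfRecord F N)) :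
    ∀ (p : B12.RunParams) (n : ℕ) (s : SeqOfRecord F θ.ν θ.τ9.M (gOfRecord₁₃ F N θ p) p.K n) (δ : ℕ → ℝ) (W : MSField (F.P p.K) (SU N)),
      n ≤ p.K → Step.InInterval θ.γ n (gOfRecord₁₃ F N θ p) →
      Sect2.DataSmall7PTop (avOfRecord F N p.K) s.Ω (suppDomOfRecord F θ.ν p.K s.Ω) n δ W → dataSmall7LamTopOf F N p.K s.Ω (suppDomOfRecord F θ.ν p.K s.Ω) n δ W := by
  subst hθ; exact BalabanUVNodesN11BgRowGaugeSocketsGBPrint.dataSmall7LamTopOf_of_dataSmall7PTop_of_powM _ rfl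

/-- **(v1.1) `hadm` AT THE MEMBER FOR THE LEGACY FLOOR GUARD `Adm := floorGuard F c₁₅`** (dag-n11-w1's R-road convention, floor letter `hc₁₅ : c₁₅ ≤ L^j` kept): at the member
`ν.M₁ = L^j` (`rfl`), so the guard row at every window prefix IS `hc₁₅`.  For the member cone's CLASS-T consumers. [cite: Balaban1985RegularSpaces, (1.3)–(1.6) p.77; Balaban1985Variational, p.304 lines 1–2 (bookkeeping)] -/
theorem hadm_floorGuard_ccmwCR (hθ : θ = theta13LiveOfNumerics F N
      ({ stage12NumericsOfThm1CCMW F.L j γ ε₀ B₃ B₃' a₀ a₁ with s2 := { sect2NumericsOfThm1C F.L with cR := c } } : Stage12Numerics) ε₂₉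
      (zeta316OfRecord F N (stage12NumericsOfThm1CCMW F.L j γ ε₀ B₃ B₃' a₀ a₁).ν (stage12NumericsOfThm1CCMW F.L j γ ε₀ B₃ B₃' a₀ a₁).τ9.M
        (stage12NumericsOfThm1CCMW F.L j γ ε₀ B₃ B₃' a₀ a₁).A₁) (RzOfRecord F N) (ZtOfRecord F N)) {c₁₅ : ℕ} (hc₁₅ : c₁₅ ≤ F.L ^ j) :
    ∀ (p : B12.RunParams) (n : ℕ), n ≤ p.K → Step.InInterval θ.γ n (gOfRecord₁₃ F N θ p) →
      ∀ s : SeqOfRecord F θ.ν θ.τ9.M (gOfRecord₁₃ F N θ p) p.K n, floorGuard F c₁₅ θ.ν θ.τ9.M (gOfRecord₁₃ F N θ p) p.K n s := by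
  have hM₁ : θ.ν.M₁ = F.L ^ j := by subst hθ; rfl
  intro p n _ _ s
  exact (floorGuard_apply c₁₅ θ.ν θ.τ9.M (gOfRecord₁₃ F N θ p) p.K n s).mpr (hM₁ ▸ hc₁₅)

/-- **(v1.1) THE `hbgs` BINDER AT PRINT'S DATA CLAUSE, `hDat` GONE**: §3 at `Dat := dataSmall7LamTopOf F N` with `hDat := hDat_lam_ccmwCR`.  CONDITIONAL on the ᴮ sentences at
`(Adm, lamDatum F, dataSmall7LamTopOf F N)`, `hadm`, `hseam`, (hcomp) ∧ (hcompRev); nothing of Bałaban asserted. [cite: Balaban1988Convergent, (2.28) p.259, Thm 1 p.262 (bookkeeping); Balaban1984PropagatorsII, (2.3) p.224; Balaban1985Variational, (7) p.278] -/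
theorem bgFacts_ccmwCRH_of_thm1GaugeGB_of_hcomp_of_hjm_lamPrint {θH : Stage13HParams F N} (hH : θH.toStage13Params = θ) (hθ : θ = theta13LiveOfNumerics F N
      ({ stage12NumericsOfThm1CCMW F.L j γ ε₀ B₃ B₃' a₀ a₁ with s2 := { sect2NumericsOfThm1C F.L with cR := c } } : Stage12Numerics) ε₂₉
      (zeta316OfRecord F N (stage12NumericsOfThm1CCMW F.L j γ ε₀ B₃ B₃' a₀ a₁).ν (stage12NumericsOfThm1CCMW F.L j γ ε₀ B₃ B₃' a₀ a₁).τ9.M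
        (stage12NumericsOfThm1CCMW F.L j γ ε₀ B₃ B₃' a₀ a₁).A₁) (RzOfRecord F N) (ZtOfRecord F N))
    (hjm : j + 1 ≤ F.m) (hc0 : 0 < c) (hc8 : c ≤ 8) (hγ0 : 0 < γ) (hγ : γ ≤ 1 / 2) (hε : 0 < ε₀) (hε' : 0 < ε₂₉) (hB : 0 ≤ B₃) (hB' : 0 ≤ B₃') (ha₀ : 0 < a₀) (ha₁ : 0 < a₁)
    (h15 : VariationalThm1RegSepCoP7MGB F N Adm (lamDatum F) (dataSmall7LamTopOf F N) B₃ a₀ a₁)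
    (h15G : VariationalThm1GaugeRegSepCoP7MGB F N (F.L ^ j) Adm (lamDatum F) (dataSmall7LamTopOf F N) B₃ B₃' a₀ a₁)
    (hadm : ∀ (p : B12.RunParams) (n : ℕ), n ≤ p.K → Step.InInterval θ.γ n (gOfRecord₁₃ F N θ p) →
      ∀ s : SeqOfRecord F θ.ν θ.τ9.M (gOfRecord₁₃ F N θ p) p.K n, Adm θ.ν θ.τ9.M (gOfRecord₁₃ F N θ p) p.K n s)
    (hseam : ∀ (θ' : Stage13Params F N) (p : B12.RunParams) (n : ℕ) (s : SeqOfRecord F θ'.ν θ'.τ9.M (gOfRecord₁₃ F N θ' p) p.K (n + 1)) (W : MSField (F.P p.K) (SU N)),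
      UbgOfRecord₁₃CoP F N θ' p (n + 1) s W = UbgMSCoPOfRecordB F N θ'.ν θ'.τ9.M (gOfRecord₁₃ F N θ' p) p.K (n + 1) s W)
    (hcomp : ∀ (p : B12.RunParams) (n : ℕ), n ≤ p.K → Step.InInterval θ.γ n (gOfRecord₁₃ F N θ p) → ∀ m, m < n →
      θ.s2.cR * epsOfRecord θ.ν (gOfRecord₁₃ F N θ p) m ≤ 2 * (θ.s2.cR * epsOfRecord θ.ν (gOfRecord₁₃ F N θ p) (m + 1)))
    (hcompRev : ∀ (p : B12.RunParams) (n : ℕ), n ≤ p.K → Step.InInterval θ.γ n (gOfRecord₁₃ F N θ p) → ∀ m, m < n →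
      θ.s2.cR * epsOfRecord θ.ν (gOfRecord₁₃ F N θ p) (m + 1) ≤ 2 * (θ.s2.cR * epsOfRecord θ.ν (gOfRecord₁₃ F N θ p) m)) {γ' : ℝ} (hγ' : γ' ≤ θ.γ) :
    ∀ P : B12.RunParams, Step.InInterval γ' P.K (gOfRecord₁₃ F N θH.toStage13Params P) → ∀ k, k ≤ P.K →
      BgProvisoΛ F N P.K (settingOfRecord₁₃ F N θH.toStage13Params P) (θH.Rz P.K) θH.τ9.M k (suppOfRecord₁₃SepCoP F N θH.toStage13Params P k)
        (UbgOfRecord₁₃CoP F N θH.toStage13Params P k) :=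
  bgFacts_ccmwCRH_of_thm1GaugeGB_of_hcomp_of_hjm_lam hH hθ hjm hc0 hc8 hγ0 hγ hε hε' hB hB' ha₀ ha₁ h15 h15G hadm (hDat_lam_ccmwCR hθ) hseam hcomp hcompRev hγ'

end Summit.QuantumFields.YangMills.Theorems.BalabanUVNodesN11BgRowGaugeRAtCRLetteredMemberB

end
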